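import Summits.HodgeConjecture.HodgeConjecture.Theorems.EightfoldBlochSeedsChernCharacterOnBettiAnalytificationFlag
import Summits.HodgeConjecture.HodgeConjecture.Theorems.EightfoldBlochSeedsChernCharacterOnBettiAnalytificationFlagChern
import Summits.HodgeConjecture.HodgeConjecture.Theorems.EightfoldBlochSeedsChernCharacterOnBettiAnalytificationPullbackVectorBundle
import Summits.HodgeConjecture.HodgeConjecture.Theorems.EightfoldBlochSeedsChernCharacterOnBettiAnalytificationVectorBundle
import Literature.AlgebraicGeometry.HodgeTheory.FlagBundleSplitting
import Literature.AlgebraicGeometry.HodgeTheory.SurjectivePullbackConiveauDescent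
import HarnessLib

/-!
# K1 → the cycle law `ch_mem_algebraicClasses` for EVERY vector bundle on a smooth projective `X`,
# granted the flag bundle (`FlagBundleSplitting`)

Route `EightfoldBlochSeeds` / item `stmt-HodgeConjecture-19780` (`ChernCharacterOnBetti`), helper
(`--supports`). HONEST FRAMING: nothing here proves 19780 / 18880 / 18882 / 18883 / H2 / HC_AV / HC;
no definition; ONE named fact is taken as a hypothesis (`hFB : FlagBundleSplitting`, Fulton §3.2 /
Grothendieck 1958 §2, `Literature/AlgebraicGeometry/HodgeTheory/FlagBundleSplitting`), so every
theorem here is CONDITIONAL on it (D-0014).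

WHAT. The field `ch_mem_algebraicClasses` of `ChernCharacterBetti` for the analytified Chern character
on a smooth projective `X`: for every vector bundle `F` on `X`, every topological analytification datum
`(E, α)` of `F` and every `k`, `ch_k(E) ∈ algebraicClasses X k = Nᵏ H²ᵏ(X(ℂ); ℂ)`
(`topologicalChernCharacter_mem_algebraicClasses_of_comparison`), and the same for the complexified
Chern classes `cᵢ(E)_ℂ` (`chernClassIn_complex_mem_algebraicClasses_of_comparison`); packaged with
the existence of a datum (`…AnalytificationVectorBundle`) as
`exists_analytification_topologicalChernCharacter_mem_algebraicClasses`.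

HOW (Grothendieck's splitting-principle reduction, [Grothendieck1958, §2]; [Fulton1998, §3.2]).
`FlagBundleSplitting` gives `g : Y ⟶ X` SURJECTIVE from a smooth projective `Y` with
`HasFullFlag (g^*F)`; `g^* ch_k(E) = ch_k(E')` for a datum `E'` of `g^*F` (K1e,
`topologicalChernCharacter_pullback_of_comparison`); `ch_k(E') ∈ Nᵏ(Y)` (the flagged case,
`…AnalytificationFlag`); and algebraicity DESCENDS along the surjective `g` — the tree's PROVED
`mem_algebraicClasses_of_map_mem_of_surjective'` (`x = c⁻¹ g_*(ηʳ ∪ g^* x)`, Voisin I Lemma 7.28 with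
the wedge kept / Remark 7.29; `HodgeTheory/SurjectivePullbackConiveauDescent`). Compared with
`…AnalytificationSplitting` (p828378), which took the flag map TOGETHER WITH a Gysin section
`g_*(ξᵈ) = a · 1` as hypotheses, the Gysin section is no longer an input: surjectivity of the flag map
suffices, and the one remaining input is the purely algebro-geometric named fact.

[cite: Grothendieck1958, §2] [cite: Fulton1998, §3.2 and Prop. 19.1.2] [cite: Voisin2025, §4.3]
[cite: VoisinHodgeI2002, §7.3.2 Lemma 7.28 and Remark 7.29] [cite: SerreGAGA1956, §3 n°9 Prop. 10 and n°11]
-/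

noncomputable section

-- single-problem summit (Problem = Summit): the mandated namespace repeats `HodgeConjecture`.
set_option linter.dupNamespace false

open CategoryTheory AlgebraicGeometry Bundle Topology
open Literature.AlgebraicGeometry.Motives Literature.AlgebraicGeometry.HodgeTheory Literature.AlgebraicGeometry.Modules
open Literature.AlgebraicTopology.SingularHomology Literature.AlgebraicTopology.CharacteristicClasses

namespace Summit.HodgeConjecture.HodgeConjecture.Theorems

variable {n : ℕ} {X : SchemeOver ℂ} {F : X.left.Modules} {r : ℕ}

/-- **`ch_k(F(ℂ)) ∈ algebraicClasses X k` for EVERY vector bundle `F` on a smooth projective `X`,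
granted `FlagBundleSplitting`**, for every analytification datum `(E, α)` of `F` and every `k`
(pull back to the flag map, where `g^*F` is flagged and the flagged case applies, and descend along
the surjective `g`). [cite: Grothendieck1958, §2] [cite: Fulton1998, §3.2 and Prop. 19.1.2]
[cite: VoisinHodgeI2002, §7.3.2 Lemma 7.28 and Remark 7.29] [cite: Voisin2025, §4.3] -/
theorem topologicalChernCharacter_mem_algebraicClasses_of_comparison (hFB : FlagBundleSplitting)
    (hX : IsSmoothProjective n X) (hF : IsVectorBundle F)
    (hFr : ∀ x : X.left, ∃ (U : X.left.Opens) (s : Fin r → Γ(F, U)), x ∈ U ∧ IsSectionFrame F U s)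
    (E : ComplexVectorBundle.{0, 0} (ComplexPoints X))
    (α : ∀ U : X.left.Opens, Γ(F, U) → ∀ P : ComplexPoints X, E.E P)
    (hadd : ∀ (U : X.left.Opens) (σ τ : Γ(F, U)) (P : ComplexPoints X), α U (σ + τ) P = α U σ P + α U τ P)
    (hsmul : ∀ (U : X.left.Opens) (f : Γ(X.left, U)) (σ : Γ(F, U)) (P : ComplexPoints X) (h : P.pt ∈ U),
      α U (f • σ) P = P.eval U h f • α U σ P)
    (hres : ∀ (U W : X.left.Opens) (hWU : W ≤ U) (σ : Γ(F, U)) (P : ComplexPoints X), P.pt ∈ W →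
      α W (F.presheaf.map (homOfLE hWU).op σ) P = α U σ P)
    (hcont : ∀ (U : X.left.Opens) (σ : Γ(F, U)),
      ContinuousOn (fun P ↦ (⟨P, α U σ P⟩ : TotalSpace E.F E.E)) {P | P.pt ∈ U})
    (hframe : ∀ (U : X.left.Opens) (t : Fin r → Γ(F, U)), IsSectionFrame F U t →
      ∀ P : ComplexPoints X, P.pt ∈ U → LinearIndependent ℂ (fun j ↦ α U (t j) P) ∧
        ⊤ ≤ Submodule.span ℂ (Set.range fun j ↦ α U (t j) P)) (k : ℕ) :
    theChernClassTheory.topologicalChernCharacter ℂ E k ∈ algebraicClasses X k := by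
  -- the flag map: `g : Y ⟶ X` surjective, `Y` smooth projective, `g^*F` flagged
  obtain ⟨m, Y, g, hY, hg, hflag⟩ := hFB n X hX F hF
  haveI := IsSmoothProjective.isIntegral_holds hX
  haveI := IsSmoothProjective.isIntegral_holds hY
  -- trivialisations of one size and a datum of `g^*F`
  obtain ⟨r₀, hFr₀⟩ := exists_free_fin_iso_of_isVectorBundle hF
  have hF' : IsVectorBundle ((Scheme.Modules.pullback g.left).obj F) :=
    ((isFiniteLocallyFree_of_isVectorBundle hF).pullback g.left).isVectorBundle
  obtain ⟨r', E', α', -, hfr', hadd', hsmul', hres', hcont', hframe'⟩ :=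
    exists_topologicalAnalytification_of_isVectorBundle hY hF'
  obtain ⟨x₀⟩ := (inferInstance : Nonempty X.left)
  obtain rfl : r = r₀ := by
    obtain ⟨U, e, hx⟩ := hFr₀ x₀
    obtain ⟨U₁, s₁, hx₁, hs₁⟩ := hFr x₀
    exact frame_card_eq hs₁ (isSectionFrame_basisSection e (Equiv.refl _)) hx₁ hx
  obtain ⟨y₀⟩ := (inferInstance : Nonempty Y.left)
  obtain rfl : r' = r := by
    obtain ⟨U, e, hx⟩ := hFr₀ (g.left.base y₀)
    obtain ⟨U₂, s₂, hy₂, hs₂⟩ := hfr' y₀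
    exact frame_card_eq hs₂ (isSectionFrame_unitSection g e (Equiv.refl _)) hy₂ hx
  -- `g^* ch_k(E) = ch_k(E')`, `ch_k(E')` is algebraic (flag), and algebraicity descends along `g`
  have hpull := topologicalChernCharacter_pullback_of_comparison g hX hY hFr₀ E E' α α' hadd hsmul hres
    hcont hframe hadd' hsmul' hres' hcont' hframe' k
  have hY' := topologicalChernCharacter_mem_algebraicClasses_of_comparison_of_hasFullFlag hY hflag hfr' E' α'
    hadd' hsmul' hres' hcont' hframe' k
  refine mem_algebraicClasses_of_map_mem_of_surjective' hY hX g ?_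
  rw [hpull]
  exact hY'

/-- **`cᵢ(F(ℂ))_ℂ ∈ algebraicClasses X i` for EVERY vector bundle `F` on a smooth projective `X`,
granted `FlagBundleSplitting`**, for every analytification datum `(E, α)` of `F` and every `i`.
[cite: Grothendieck1958, §2] [cite: Fulton1998, §3.2 and Prop. 19.1.2]
[cite: VoisinHodgeI2002, §7.3.2 Lemma 7.28 and Remark 7.29] [cite: Voisin2025, §4.3] -/
theorem chernClassIn_complex_mem_algebraicClasses_of_comparison (hFB : FlagBundleSplitting)
    (hX : IsSmoothProjective n X) (hF : IsVectorBundle F)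
    (hFr : ∀ x : X.left, ∃ (U : X.left.Opens) (s : Fin r → Γ(F, U)), x ∈ U ∧ IsSectionFrame F U s)
    (E : ComplexVectorBundle.{0, 0} (ComplexPoints X))
    (α : ∀ U : X.left.Opens, Γ(F, U) → ∀ P : ComplexPoints X, E.E P)
    (hadd : ∀ (U : X.left.Opens) (σ τ : Γ(F, U)) (P : ComplexPoints X), α U (σ + τ) P = α U σ P + α U τ P)
    (hsmul : ∀ (U : X.left.Opens) (f : Γ(X.left, U)) (σ : Γ(F, U)) (P : ComplexPoints X) (h : P.pt ∈ U),
      α U (f • σ) P = P.eval U h f • α U σ P)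
    (hres : ∀ (U W : X.left.Opens) (hWU : W ≤ U) (σ : Γ(F, U)) (P : ComplexPoints X), P.pt ∈ W →
      α W (F.presheaf.map (homOfLE hWU).op σ) P = α U σ P)
    (hcont : ∀ (U : X.left.Opens) (σ : Γ(F, U)),
      ContinuousOn (fun P ↦ (⟨P, α U σ P⟩ : TotalSpace E.F E.E)) {P | P.pt ∈ U})
    (hframe : ∀ (U : X.left.Opens) (t : Fin r → Γ(F, U)), IsSectionFrame F U t →
      ∀ P : ComplexPoints X, P.pt ∈ U → LinearIndependent ℂ (fun j ↦ α U (t j) P) ∧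
        ⊤ ≤ Submodule.span ℂ (Set.range fun j ↦ α U (t j) P)) (i : ℕ) :
    theChernClassTheory.chernClassIn ℂ E i ∈ algebraicClasses X i := by
  obtain ⟨m, Y, g, hY, hg, hflag⟩ := hFB n X hX F hF
  haveI := IsSmoothProjective.isIntegral_holds hX
  haveI := IsSmoothProjective.isIntegral_holds hY
  obtain ⟨r₀, hFr₀⟩ := exists_free_fin_iso_of_isVectorBundle hF
  have hF' : IsVectorBundle ((Scheme.Modules.pullback g.left).obj F) :=
    ((isFiniteLocallyFree_of_isVectorBundle hF).pullback g.left).isVectorBundle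
  obtain ⟨r', E', α', -, hfr', hadd', hsmul', hres', hcont', hframe'⟩ :=
    exists_topologicalAnalytification_of_isVectorBundle hY hF'
  obtain ⟨x₀⟩ := (inferInstance : Nonempty X.left)
  obtain rfl : r = r₀ := by
    obtain ⟨U, e, hx⟩ := hFr₀ x₀
    obtain ⟨U₁, s₁, hx₁, hs₁⟩ := hFr x₀
    exact frame_card_eq hs₁ (isSectionFrame_basisSection e (Equiv.refl _)) hx₁ hx
  obtain ⟨y₀⟩ := (inferInstance : Nonempty Y.left)
  obtain rfl : r' = r := by
    obtain ⟨U, e, hx⟩ := hFr₀ (g.left.base y₀)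
    obtain ⟨U₂, s₂, hy₂, hs₂⟩ := hfr' y₀
    exact frame_card_eq hs₂ (isSectionFrame_unitSection g e (Equiv.refl _)) hy₂ hx
  -- `g^* cᵢ(E)_ℂ = cᵢ(E')_ℂ` (K1e, integrally, then change of coefficients)
  have hZ := chernClassZ_pullback_of_comparison g hX hY hFr₀ E E' α α' hadd hsmul hres hcont hframe hadd' hsmul'
    hres' hcont' hframe' i
  have hpull : complexBetti.map g (2 * i) (theChernClassTheory.chernClassIn ℂ E i) =
      theChernClassTheory.chernClassIn ℂ E' i := by
    change singularCohomology.map ℂ ℂ (AlgPoints.mapContinuous g) (2 * i)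
      (singularCohomology.ringChange (Int.castRingHom ℂ) (ComplexPoints X) (2 * i) (chernClassZ E i)) =
      singularCohomology.ringChange (Int.castRingHom ℂ) (ComplexPoints Y) (2 * i) (chernClassZ E' i)
    rw [← Literature.AlgebraicTopology.CharacteristicClasses.ringChange_map, hZ]
  have hY' := chernClassIn_complex_mem_algebraicClasses_of_comparison_of_hasFullFlag hY hflag hfr' E' α'
    hadd' hsmul' hres' hcont' hframe' i
  refine mem_algebraicClasses_of_map_mem_of_surjective' hY hX g ?_
  rw [hpull]
  exact hY'

/-- **Packaged with the existence of a datum**: granted `FlagBundleSplitting`, every vector bundle `F`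
on a smooth projective `X` over `ℂ` has a topological analytification `(E, α)` (of some rank `r`, with
algebraic frames of size `r` near every point, Serre's comparison maps) ALL of whose Chern character
components and complexified Chern classes are algebraic classes:
`ch_k(E) ∈ algebraicClasses X k` and `cᵢ(E)_ℂ ∈ algebraicClasses X i` for all `k`, `i`.
[cite: SerreGAGA1956, §3 n°9 Déf. 2, Prop. 10 and §4 n°20] [cite: Grothendieck1958, §2]
[cite: Fulton1998, §3.2 and Prop. 19.1.2] -/
theorem exists_analytification_topologicalChernCharacter_mem_algebraicClasses (hFB : FlagBundleSplitting)
    (hX : IsSmoothProjective n X) (hF : IsVectorBundle F) :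
    ∃ (r : ℕ) (E : ComplexVectorBundle.{0, 0} (ComplexPoints X))
      (α : ∀ U : X.left.Opens, Γ(F, U) → ∀ P : ComplexPoints X, E.E P),
      E.rank = r ∧
      (∀ x : X.left, ∃ (U : X.left.Opens) (s : Fin r → Γ(F, U)), x ∈ U ∧ IsSectionFrame F U s) ∧
      (∀ (U : X.left.Opens) (σ τ : Γ(F, U)) (P : ComplexPoints X),
          α U (σ + τ) P = α U σ P + α U τ P) ∧
      (∀ (U : X.left.Opens) (f : Γ(X.left, U)) (σ : Γ(F, U)) (P : ComplexPoints X) (h : P.pt ∈ U),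
          α U (f • σ) P = P.eval U h f • α U σ P) ∧
      (∀ (U W : X.left.Opens) (hWU : W ≤ U) (σ : Γ(F, U)) (P : ComplexPoints X), P.pt ∈ W →
          α W (F.presheaf.map (homOfLE hWU).op σ) P = α U σ P) ∧
      (∀ (U : X.left.Opens) (σ : Γ(F, U)),
          ContinuousOn (fun P ↦ (⟨P, α U σ P⟩ : TotalSpace E.F E.E)) {P | P.pt ∈ U}) ∧
      (∀ (U : X.left.Opens) (t : Fin r → Γ(F, U)), IsSectionFrame F U t → ∀ P : ComplexPoints X,
          P.pt ∈ U → LinearIndependent ℂ (fun j ↦ α U (t j) P) ∧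
            ⊤ ≤ Submodule.span ℂ (Set.range fun j ↦ α U (t j) P)) ∧
      (∀ k : ℕ, theChernClassTheory.topologicalChernCharacter ℂ E k ∈ algebraicClasses X k) ∧
      (∀ i : ℕ, theChernClassTheory.chernClassIn ℂ E i ∈ algebraicClasses X i) := by
  obtain ⟨r, E, α, hrank, hfr, hadd, hsmul, hres, hcont, hframe⟩ :=
    exists_topologicalAnalytification_of_isVectorBundle hX hF
  exact ⟨r, E, α, hrank, hfr, hadd, hsmul, hres, hcont, hframe,
    fun k ↦ topologicalChernCharacter_mem_algebraicClasses_of_comparison hFB hX hF hfr E α hadd hsmul hres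
      hcont hframe k,
    fun i ↦ chernClassIn_complex_mem_algebraicClasses_of_comparison hFB hX hF hfr E α hadd hsmul hres
      hcont hframe i⟩

end Summit.HodgeConjecture.HodgeConjecture.Theorems

end
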